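import Summits.BirchSwinnertonDyer.BirchSwinnertonDyer.Theorems.PrintCFramBottomClassIndexLawFiveLeHerbrandSelmerToHomPrimes
import Literature.NumberTheory.GaloisRepresentations.AbsIntegersEquiv
import Literature.NumberTheory.GaloisRepresentations.ArtinRestriction
import HarnessLib

/-!
# Crux `PrintCFram.BottomClassIndexLawFiveLe` (stmt-BirchSwinnertonDyer-20372), line `eisenstein-resource-bdp-line` (v10):
# Stub H, Road A step A2 — BASE CHANGE of the Hom-socket to the number field `L` with `res(Γ_L) = N_θ`

Cell `bsd-print-cfram`, width seat `bsd-line-cfram-p1-w4` (generation g5), `--supports stmt-BirchSwinnertonDyer-20372` (helper);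
fourth file of the T2′ series (p648816, p649370, p651053). THEOREMS ONLY; no definition, no named fact, no `sorry`. BSD is not proved by
any of this; no summit statement is proved by this seat; no stub is closed.

WHY (LEAD g8 report `Lines/eisenstein-resource-bdp-line-lead-g8.md` §4, Road A): after (A1) the obligation of Stub H is a Hom-vanishing
statement for `θ`-equivariant continuous homomorphisms on the subgroup `N_θ = ker θ ≤ Γ_K` (`K = K''`), with local conditions at primes of
`\bar ℤ_K` (`HerbrandSelmerToHom.datumStrictSelmer_bdpData_eq_bot_of_forall_hom_character_primesAbove`, p651053). Class field theory in the
tree (ray class fields `narrowRayClassField_galEquivRayClassGroup`, the conductor theorem, the Hilbert class field) is stated for a NUMBER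
FIELD `L` as a Type — its absolute Galois group `Γ_L = Gal(L̄/L)`, its places `HeightOneSpectrum (𝓞 L)`, the primes of `\bar ℤ_L`. Step (A2)
is the passage `N_θ = res(Γ_L)`: this file proves it.

* §1 `range_absGaloisRestrict_fixedField_eq_of_normal` — for `K` of characteristic `0` and an OPEN NORMAL `N ≤ Γ_K`, the restriction
  `Γ_L → Γ_K` of the fixed field `L = K̄^N` (as a Type, through the tree's chosen `K`-isomorphism `K̄ ≅ L̄`, `absGaloisRestrict`) has image
  EXACTLY `N` (tree `exists_mem_range_absGaloisRestrict_fixedField_iff`: a conjugate `g N g⁻¹`; normality). So the hypothesis `hL` below is met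
  by `L = K̄^{N_θ}` (finite over `K`: `finiteDimensional_fixedField_of_isOpen`).
* §2 **`datumStrictSelmer_bdpData_eq_bot_of_forall_hom_field`** — for ANY `L` (`[NumberField L] [Algebra K L]`) with
  `∀ g, g ∈ (absGaloisRestrict K L).range ↔ θ g = 1`: **`datumStrictSelmer H M p (bdpData M p 𝔭) S₀ = ⊥`** as soon as every CONTINUOUS
  HOMOMORPHISM `φ : Γ_L → ℤ/p`, `θ`-equivariant along `res` (`res τ' = σ · res τ · σ⁻¹ ⟹ φ τ' = θ σ · φ τ`), killing the inertia group
  `𝔔.inertia Γ_L` of every prime `𝔔` of `\bar ℤ_L` above every place `u` of `L` over some `v ∉ S₀`, `v ∤ p`, and the decomposition group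
  `𝔔.decompositionSubgroup Γ_L` of every `𝔔` above every `u` over `𝔭`, vanishes identically. (Transport `φ = f ∘ res`; primes of `\bar ℤ_K`
  and of `\bar ℤ_L` correspond under the tree's `absIntegersEquiv`, with `res⁻¹(I_{𝔔 ∩ \bar ℤ_K}) = I_𝔔`, `res⁻¹(D_{𝔔 ∩ \bar ℤ_K}) = D_𝔔` —
  `comap_inertia_comap_absIntegersMap`, `comap_decompositionSubgroup_comap_absIntegersMap`.)
* §3 ON THE CLASS (Stub H's quantifiers): `bottomResidualSelmer_sub_eq_bot_of_forall_hom_field` / `…_quot_…`.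

After this file the T4 prover's obligation lives over the number field `L` only: «every continuous character `φ : Γ_L → 𝔽_p` unramified
outside the places over `S₀ ∪ {𝔭̄}`, split at the places over `𝔭`, and `θ`-equivariant, is trivial» — the input shape of (A3)
(`φ` factors through `Cl_L^𝔪`). With w7's S-erasure (p650489) take `S₀ = ∅`.

References: Neukirch, *Algebraic Number Theory* I §9 (9.4)–(9.6), IV §1; Milne, *Fields and Galois Theory* §7; Greenberg, LNM 1716 §3;
the LEAD g8 report §4 (crux workfile).
-/

noncomputable section

-- summit-side namespace `Summit.BirchSwinnertonDyer.BirchSwinnertonDyer.…` (single-conjunct summit, D-0017 layout)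
set_option linter.dupNamespace false
set_option autoImplicit false

open scoped Classical Pointwise
open NumberField WeierstrassCurve IsDedekindDomain Field
open Literature.NumberTheory.EllipticCurves
open Literature.NumberTheory.EllipticCurves.GreenbergSelmer
open Literature.NumberTheory.EllipticCurves.GreenbergVatsal2000
open Literature.NumberTheory.GaloisRepresentations
open Summit.BirchSwinnertonDyer.Rank1Residual
open Summit.BirchSwinnertonDyer.Rank1Residual.X11b

namespace Summit.BirchSwinnertonDyer.BirchSwinnertonDyer.Theorems.PrintCFram.HerbrandSelmerToHom

/-! ## §1 The fixed field of an open normal subgroup: `res(Γ_{K̄^N}) = N` -/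

section FixedField

variable {K : Type} [Field K] [CharZero K]

/-- **`res(Γ_L) = N` for `L = K̄^N`, `N` open NORMAL.** The image of the restriction `Γ_L → Γ_K` of the fixed field of an open subgroup
is a conjugate `g N g⁻¹` (tree `exists_mem_range_absGaloisRestrict_fixedField_iff`, the chosen `K`-isomorphism `K̄ ≅ L̄`); for normal `N`
it is `N` itself. [cite: NeukirchANT1999, Ch. IV §1] -/
theorem range_absGaloisRestrict_fixedField_eq_of_normal (N : Subgroup (absoluteGaloisGroup K)) [N.Normal]
    (hN : IsOpen (N : Set (absoluteGaloisGroup K))) :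
    (absGaloisRestrict K (IntermediateField.fixedField N : IntermediateField K (AlgebraicClosure K))).range = N := by
  obtain ⟨g, hg⟩ := exists_mem_range_absGaloisRestrict_fixedField_iff N hN
  ext γ
  rw [hg γ]
  constructor
  · intro h
    have h' := Subgroup.Normal.conj_mem inferInstance _ h g
    rwa [show g * (g⁻¹ * γ * g) * g⁻¹ = γ by group] at h'
  · intro h
    have h' := Subgroup.Normal.conj_mem inferInstance _ h g⁻¹
    rwa [inv_inv] at h'

/-- The same, membership form: `γ ∈ res(Γ_{K̄^N}) ↔ γ ∈ N`. [cite: NeukirchANT1999, Ch. IV §1] -/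
theorem mem_range_absGaloisRestrict_fixedField_iff_of_normal (N : Subgroup (absoluteGaloisGroup K)) [N.Normal]
    (hN : IsOpen (N : Set (absoluteGaloisGroup K))) (γ : absoluteGaloisGroup K) :
    γ ∈ (absGaloisRestrict K (IntermediateField.fixedField N : IntermediateField K (AlgebraicClosure K))).range ↔ γ ∈ N := by
  rw [range_absGaloisRestrict_fixedField_eq_of_normal N hN]

/-- `K̄^N / K` is finite for `N` open. (Tree `finiteDimensional_fixedField_of_isOpen`, restated.) [cite: NeukirchANT1999, Ch. IV §1] -/
theorem finiteDimensional_fixedField (N : Subgroup (absoluteGaloisGroup K)) (hN : IsOpen (N : Set (absoluteGaloisGroup K))) :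
    FiniteDimensional K (IntermediateField.fixedField N : IntermediateField K (AlgebraicClosure K)) :=
  finiteDimensional_fixedField_of_isOpen N hN

end FixedField

/-! ## §2 Transport of the Hom-socket along `res : Γ_L → Γ_K` -/

section Transport

variable {K : Type} [Field K] [NumberField K] {L : Type} [Field L] [NumberField L] [Algebra K L]

/-- For number fields `K ⊆ L`, `L/K` is finite and algebraic. [folklore] -/
theorem isAlgebraic_of_numberField : Algebra.IsAlgebraic K L := by
  haveI : FiniteDimensional K L := Module.Finite.of_restrictScalars_finite ℚ K L
  infer_instance

/-- **Primes of `\bar ℤ_K` come from primes of `\bar ℤ_L`.** For every prime `𝔓` of `\bar ℤ_K` above the place `v` of `K` there are a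
place `u` of `L` above `v` and a prime `𝔔` of `\bar ℤ_L` above `u` whose contraction along the chosen `\bar ℤ_K ≅ \bar ℤ_L`
(`absIntegersMap K L`) is `𝔓`. [cite: NeukirchANT1999, Ch. I §9] -/
theorem exists_place_prime_comap_eq {v : HeightOneSpectrum (𝓞 K)} {𝔓 : Ideal (absIntegers (𝓞 K) K)} (h𝔓 : 𝔓 ∈ v.primesAbove) :
    ∃ (u : HeightOneSpectrum (𝓞 L)) (𝔔 : Ideal (absIntegers (𝓞 L) L)),
      u.asIdeal.under (𝓞 K) = v.asIdeal ∧ 𝔔 ∈ u.primesAbove ∧ 𝔔.comap (absIntegersMap K L) = 𝔓 := by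
  haveI : Algebra.IsAlgebraic K L := isAlgebraic_of_numberField
  haveI := h𝔓.1
  let e : absIntegers (𝓞 K) K ≃+* absIntegers (𝓞 L) L := absIntegersEquiv K L
  let 𝔔 : Ideal (absIntegers (𝓞 L) L) := 𝔓.comap e.symm.toRingHom
  have hcomap : 𝔔.comap (absIntegersMap K L) = 𝔓 := by
    change Ideal.comap (absIntegersMap K L) (Ideal.comap e.symm.toRingHom 𝔓) = 𝔓
    rw [Ideal.comap_comap, ← coe_absIntegersEquiv]
    change Ideal.comap (e.symm.toRingHom.comp e.toRingHom) 𝔓 = 𝔓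
    rw [RingEquiv.symm_toRingHom_comp_toRingHom, Ideal.comap_id]
  haveI : 𝔔.IsPrime := Ideal.IsPrime.comap _
  have h : 𝔔.comap (absIntegersMap K L) ∈ v.primesAbove := by rw [hcomap]; exact h𝔓
  obtain ⟨u, hu, h𝔔u, -⟩ := exists_heightOneSpectrum_of_comap_absIntegersMap_mem_primesAbove h
  exact ⟨u, 𝔔, hu, h𝔔u, hcomap⟩

/-- `res⁻¹(I_{𝔔 ∩ \bar ℤ_K}) = I_𝔔` on elements: `τ ∈ I_𝔔 ↔ res τ ∈ I_{𝔔 ∩ \bar ℤ_K}`. [cite: NeukirchANT1999, Ch. I §9 (9.4)–(9.6)] -/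
theorem mem_inertia_iff_absGaloisRestrict_mem (𝔔 : Ideal (absIntegers (𝓞 L) L)) (τ : absoluteGaloisGroup L) :
    τ ∈ 𝔔.inertia (absoluteGaloisGroup L) ↔
      absGaloisRestrict K L τ ∈ (𝔔.comap (absIntegersMap K L)).inertia (absoluteGaloisGroup K) := by
  haveI : Algebra.IsAlgebraic K L := isAlgebraic_of_numberField
  rw [← comap_inertia_comap_absIntegersMap K L 𝔔, Subgroup.mem_comap]
  rfl

/-- `res⁻¹(D_{𝔔 ∩ \bar ℤ_K}) = D_𝔔` on elements. [cite: NeukirchANT1999, Ch. I §9 (9.4)–(9.6)] -/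
theorem mem_decompositionSubgroup_iff_absGaloisRestrict_mem (𝔔 : Ideal (absIntegers (𝓞 L) L)) (τ : absoluteGaloisGroup L) :
    τ ∈ 𝔔.decompositionSubgroup (absoluteGaloisGroup L) ↔
      absGaloisRestrict K L τ ∈ (𝔔.comap (absIntegersMap K L)).decompositionSubgroup (absoluteGaloisGroup K) := by
  haveI : Algebra.IsAlgebraic K L := isAlgebraic_of_numberField
  rw [← comap_decompositionSubgroup_comap_absIntegersMap K L 𝔔, Subgroup.mem_comap]
  rfl

variable {p : ℕ} [hp : Fact p.Prime]
variable (H : Subgroup (absoluteGaloisGroup K)) [H.Normal]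
variable {M : Type} [AddCommGroup M] [DistribMulAction (absoluteGaloisGroup K) M] [TopologicalSpace M] [DiscreteTopology M]

/-- **THE SOCKET OVER THE NUMBER FIELD `L` (Road A, step A2).** `K` a number field, `M` a discrete `Γ_K`-module of prime order `p` with
continuous orbit maps and non-trivial action, `θ` its character (T2: `g • m = θ(g) • m`, `θ g = 1 ↔ g` acts trivially), `H ∋` every `g`
(`κ.layerSubgroup 0`), `L` ANY number field over `K` whose absolute Galois group restricts ONTO `ker θ` (e.g. `L = K̄^{ker θ}`, §1). Then
**`datumStrictSelmer H M p (bdpData M p 𝔭) S₀ = ⊥`** as soon as: every continuous homomorphism `φ : Γ_L → ℤ/p` which is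
`θ`-equivariant along `res` (`res τ' = σ · res τ · σ⁻¹ ⟹ φ τ' = θ σ · φ τ`), kills `I_𝔔 ≤ Γ_L` for every prime `𝔔` of `\bar ℤ_L` above every
place `u` of `L` lying over some `v ∉ S₀` with `v ∤ p`, and kills `D_𝔔 ≤ Γ_L` for every `𝔔` above every `u` over `𝔭`, is identically `0`.
[cite: GreenbergLNM1716, §3 (PDF p. 86)] [cite: NeukirchANT1999, Ch. I §9 (9.4)–(9.6)] [cite: NeukirchANT1999, Ch. IV §1] -/
theorem datumStrictSelmer_bdpData_eq_bot_of_forall_hom_field (hH : ∀ g : absoluteGaloisGroup K, g ∈ H)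
    (hcard : Nat.card M = p) (hcont : ∀ m : M, Continuous fun g : absoluteGaloisGroup K ↦ g • m)
    (hnt : ∃ (σ : absoluteGaloisGroup K) (a : M), σ • a ≠ a)
    (θ : absoluteGaloisGroup K →* (ZMod p)ˣ)
    (hθ : ∀ (g : absoluteGaloisGroup K) (m : M), g • m = (((θ g : ZMod p).val : ℕ) : ℤ) • m)
    (hker : ∀ g : absoluteGaloisGroup K, θ g = 1 ↔ ∀ m : M, g • m = m)
    (hL : ∀ g : absoluteGaloisGroup K, g ∈ (absGaloisRestrict K L).range ↔ θ g = 1)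
    (𝔭 : HeightOneSpectrum (𝓞 K)) (h𝔭 : ((p : ℕ) : 𝓞 K) ∈ 𝔭.asIdeal) (S₀ : Set (HeightOneSpectrum (𝓞 K)))
    (hhom : ∀ φ : absoluteGaloisGroup L → ZMod p, Continuous φ →
      (∀ a b : absoluteGaloisGroup L, φ (a * b) = φ a + φ b) →
      (∀ (σ : absoluteGaloisGroup K) (τ τ' : absoluteGaloisGroup L),
        absGaloisRestrict K L τ' = σ * absGaloisRestrict K L τ * σ⁻¹ → φ τ' = (θ σ : ZMod p) * φ τ) →
      (∀ v : HeightOneSpectrum (𝓞 K), v ∉ S₀ → ((p : ℕ) : 𝓞 K) ∉ v.asIdeal →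
        ∀ u : HeightOneSpectrum (𝓞 L), u.asIdeal.under (𝓞 K) = v.asIdeal →
          ∀ 𝔔 ∈ u.primesAbove, ∀ τ ∈ 𝔔.inertia (absoluteGaloisGroup L), φ τ = 0) →
      (∀ u : HeightOneSpectrum (𝓞 L), u.asIdeal.under (𝓞 K) = 𝔭.asIdeal →
          ∀ 𝔔 ∈ u.primesAbove, ∀ τ ∈ 𝔔.decompositionSubgroup (absoluteGaloisGroup L), φ τ = 0) →
      ∀ τ : absoluteGaloisGroup L, φ τ = 0) :
    datumStrictSelmer H M p (AcSelmer.bdpData M p 𝔭) S₀ = ⊥ := by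
  refine datumStrictSelmer_bdpData_eq_bot_of_forall_hom_character_primesAbove H hH hcard hcont hnt θ hθ hker 𝔭 h𝔭 S₀
    fun f hf hadd hconj hU hS n hn ↦ ?_
  -- `n = res τ₀`
  obtain ⟨τ₀, rfl⟩ : n ∈ (absGaloisRestrict K L).range := (hL n).2 hn
  -- the transported homomorphism `φ = f ∘ res`
  have key := hhom (fun τ ↦ f (absGaloisRestrict K L τ)) (hf.comp (absGaloisRestrict K L).continuous)
    (fun a b ↦ by
      rw [map_mul]
      exact hadd _ _ ((hL _).1 ⟨a, rfl⟩) ((hL _).1 ⟨b, rfl⟩))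
    (fun σ τ τ' h ↦ by
      rw [h]
      exact hconj σ _ ((hL _).1 ⟨τ, rfl⟩))
    (fun v hv hpv u hu 𝔔 h𝔔 τ hτ ↦ hU v hv hpv (𝔔.comap (absIntegersMap K L))
      (comap_absIntegersMap_mem_primesAbove hu h𝔔) _ ((hL _).1 ⟨τ, rfl⟩)
      ((mem_inertia_iff_absGaloisRestrict_mem 𝔔 τ).1 hτ))
    (fun u hu 𝔔 h𝔔 τ hτ ↦ hS (𝔔.comap (absIntegersMap K L)) (comap_absIntegersMap_mem_primesAbove hu h𝔔) _
      ((hL _).1 ⟨τ, rfl⟩) ((mem_decompositionSubgroup_iff_absGaloisRestrict_mem 𝔔 τ).1 hτ))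
    τ₀
  exact key

end Transport

/-! ## §3 On the class, with Stub H's quantifiers -/

section Class

variable {p : ℕ} [hp : Fact p.Prime]

/-- **Stub H's `Φ`-conjunct over the number field `L` with `res(Γ_L) = ker θ_Φ`** (e.g. `L = K̄^{ker θ_Φ} = K(Φ)`): for `W/ℚ` CM,
`p ≥ 5` CM-ramified, `K` quadratic, `κ`, `𝔭 ∋ p`, ANY stable `Φ ≤ W_K[p]` of order `p` with character `θ`, ANY `S₀`:
`datumStrictSelmer (κ.layerSubgroup 0) Φ.Sub p (bdpData Φ.Sub p 𝔭) S₀ = ⊥` as soon as every continuous homomorphism `φ : Γ_L → ℤ/p`,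
`θ`-equivariant along `res`, unramified at the primes above every `v ∉ S₀` (`v ∤ p`) and split at the primes above `𝔭`, vanishes.
[cite: GreenbergLNM1716, §3 (PDF p. 86)] [cite: KrizLi2019, p. 3 («relative p-class numbers»)] [cite: NeukirchANT1999, Ch. IV §1] -/
theorem bottomResidualSelmer_sub_eq_bot_of_forall_hom_field (W : WeierstrassCurve ℚ) [W.IsElliptic]
    (hCM : W.HasCM) (hram : Rank1Residual.CMRamified W p) (h5 : 5 ≤ p) (K : Type) [Field K] [NumberField K]
    (hK2 : Module.finrank ℚ K = 2) (κ : ZpExtension K p) (𝔭 : HeightOneSpectrum (𝓞 K))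
    (h𝔭 : ((p : ℕ) : 𝓞 K) ∈ 𝔭.asIdeal) (S₀ : Set (HeightOneSpectrum (𝓞 K)))
    (Φ : X2.ResidualDevissageModules.StableSubgroup (absoluteGaloisGroup K) ((W.baseChange K).geomTorsion (p : ℤ)))
    (hcard : Nat.card Φ.Sub = p) (θ : absoluteGaloisGroup K →* (ZMod p)ˣ)
    (hθ : ∀ (g : absoluteGaloisGroup K) (x : Φ.Sub), g • x = (((θ g : ZMod p).val : ℕ) : ℤ) • x)
    (hker : ∀ g : absoluteGaloisGroup K, θ g = 1 ↔ ∀ x : Φ.Sub, g • x = x)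
    (L : Type) [Field L] [NumberField L] [Algebra K L]
    (hL : ∀ g : absoluteGaloisGroup K, g ∈ (absGaloisRestrict K L).range ↔ θ g = 1)
    (hhom : ∀ φ : absoluteGaloisGroup L → ZMod p, Continuous φ →
      (∀ a b : absoluteGaloisGroup L, φ (a * b) = φ a + φ b) →
      (∀ (σ : absoluteGaloisGroup K) (τ τ' : absoluteGaloisGroup L),
        absGaloisRestrict K L τ' = σ * absGaloisRestrict K L τ * σ⁻¹ → φ τ' = (θ σ : ZMod p) * φ τ) →
      (∀ v : HeightOneSpectrum (𝓞 K), v ∉ S₀ → ((p : ℕ) : 𝓞 K) ∉ v.asIdeal →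
        ∀ u : HeightOneSpectrum (𝓞 L), u.asIdeal.under (𝓞 K) = v.asIdeal →
          ∀ 𝔔 ∈ u.primesAbove, ∀ τ ∈ 𝔔.inertia (absoluteGaloisGroup L), φ τ = 0) →
      (∀ u : HeightOneSpectrum (𝓞 L), u.asIdeal.under (𝓞 K) = 𝔭.asIdeal →
          ∀ 𝔔 ∈ u.primesAbove, ∀ τ ∈ 𝔔.decompositionSubgroup (absoluteGaloisGroup L), φ τ = 0) →
      ∀ τ : absoluteGaloisGroup L, φ τ = 0) :
    datumStrictSelmer (κ.layerSubgroup 0) Φ.Sub p (AcSelmer.bdpData Φ.Sub p 𝔭) S₀ = ⊥ := by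
  haveI hE : (W.baseChange K).IsElliptic := by unfold WeierstrassCurve.baseChange; infer_instance
  exact datumStrictSelmer_bdpData_eq_bot_of_forall_hom_field (κ.layerSubgroup 0)
    (fun g ↦ by rw [ZpExtension.layerSubgroup_zero]; exact Subgroup.mem_top g) hcard
    (Φ.continuous_smul_sub (HerbrandLineRestriction.continuous_smul_geomTorsion (W.baseChange K) (p : ℤ)))
    (exists_smul_ne_sub_of_cmRamified W hCM hram h5 K hK2 Φ hcard).1 θ hθ hker hL 𝔭 h𝔭 S₀ hhom

/-- **Stub H's `W[p]/Φ`-conjunct over the number field `L'` with `res(Γ_{L'}) = ker θ'`** (the quotient character; `L' = K(W[p]/Φ)`).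
[cite: GreenbergLNM1716, §3 (PDF p. 86)] [cite: GreenbergVatsal2000, §2 pp. 16–17] [cite: NeukirchANT1999, Ch. IV §1] -/
theorem bottomResidualSelmer_quot_eq_bot_of_forall_hom_field (W : WeierstrassCurve ℚ) [W.IsElliptic]
    (hCM : W.HasCM) (hram : Rank1Residual.CMRamified W p) (h5 : 5 ≤ p) (K : Type) [Field K] [NumberField K]
    (hK2 : Module.finrank ℚ K = 2) (κ : ZpExtension K p) (𝔭 : HeightOneSpectrum (𝓞 K))
    (h𝔭 : ((p : ℕ) : 𝓞 K) ∈ 𝔭.asIdeal) (S₀ : Set (HeightOneSpectrum (𝓞 K)))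
    (Φ : X2.ResidualDevissageModules.StableSubgroup (absoluteGaloisGroup K) ((W.baseChange K).geomTorsion (p : ℤ)))
    (hcard : Nat.card Φ.Sub = p) (θ' : absoluteGaloisGroup K →* (ZMod p)ˣ)
    (hθ' : ∀ (g : absoluteGaloisGroup K) (y : Φ.Quot), g • y = (((θ' g : ZMod p).val : ℕ) : ℤ) • y)
    (hker' : ∀ g : absoluteGaloisGroup K, θ' g = 1 ↔ ∀ y : Φ.Quot, g • y = y)
    (L' : Type) [Field L'] [NumberField L'] [Algebra K L']
    (hL' : ∀ g : absoluteGaloisGroup K, g ∈ (absGaloisRestrict K L').range ↔ θ' g = 1)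
    (hhom : ∀ φ : absoluteGaloisGroup L' → ZMod p, Continuous φ →
      (∀ a b : absoluteGaloisGroup L', φ (a * b) = φ a + φ b) →
      (∀ (σ : absoluteGaloisGroup K) (τ τ' : absoluteGaloisGroup L'),
        absGaloisRestrict K L' τ' = σ * absGaloisRestrict K L' τ * σ⁻¹ → φ τ' = (θ' σ : ZMod p) * φ τ) →
      (∀ v : HeightOneSpectrum (𝓞 K), v ∉ S₀ → ((p : ℕ) : 𝓞 K) ∉ v.asIdeal →
        ∀ u : HeightOneSpectrum (𝓞 L'), u.asIdeal.under (𝓞 K) = v.asIdeal →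
          ∀ 𝔔 ∈ u.primesAbove, ∀ τ ∈ 𝔔.inertia (absoluteGaloisGroup L'), φ τ = 0) →
      (∀ u : HeightOneSpectrum (𝓞 L'), u.asIdeal.under (𝓞 K) = 𝔭.asIdeal →
          ∀ 𝔔 ∈ u.primesAbove, ∀ τ ∈ 𝔔.decompositionSubgroup (absoluteGaloisGroup L'), φ τ = 0) →
      ∀ τ : absoluteGaloisGroup L', φ τ = 0) :
    datumStrictSelmer (κ.layerSubgroup 0) Φ.Quot p (AcSelmer.bdpData Φ.Quot p 𝔭) S₀ = ⊥ := by
  haveI hE : (W.baseChange K).IsElliptic := by unfold WeierstrassCurve.baseChange; infer_instance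
  exact datumStrictSelmer_bdpData_eq_bot_of_forall_hom_field (κ.layerSubgroup 0)
    (fun g ↦ by rw [ZpExtension.layerSubgroup_zero]; exact Subgroup.mem_top g)
    (HerbrandLineRestriction.natCard_quot_eq_of_card_sub (W.baseChange K) Φ hcard)
    (Φ.continuous_smul_quot (HerbrandLineRestriction.continuous_smul_geomTorsion (W.baseChange K) (p : ℤ)))
    (exists_smul_ne_sub_of_cmRamified W hCM hram h5 K hK2 Φ hcard).2 θ' hθ' hker' hL' 𝔭 h𝔭 S₀ hhom

end Class

end Summit.BirchSwinnertonDyer.BirchSwinnertonDyer.Theorems.PrintCFram.HerbrandSelmerToHom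

end
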